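import Summits.CriticalPhenomena.PercolationContinuityZ3.Theorems.PercNearOneGluingNoHeavyLowerTailStarSetForestComonotone
import Summits.CriticalPhenomena.PercolationContinuityZ3.Theorems.PercNearOneGluingNoHeavyLowerTailStarSetClassPattern
import HarnessLib

/-!
# `NoHeavyLowerTail` (stmt-CriticalPhenomena-4575) — the ALL-COMONOTONE word for CLASS FORESTS (parallel stars allowed; level `j ≤ 2`)

Support file (prover `prim-gen-swap` gen 8; `--supports stmt-CriticalPhenomena-4575`).  No definitions, no named facts, no sorries.

`StarSet.comonotone_word_nonneg_forest` (…StarSetForestComonotone) bounds the comonotone word of a two-port star family whose port graph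
is a forest indexed in a leaf-peeling order (no parallel stars).  Here PARALLEL stars are allowed: the stars `i : Fin m` are grouped into
classes `cls i : Fin M` with class ports `P, P' : Fin M → Fin n` (`p i = P (cls i)`, `p' i = P' (cls i)`), and only the CLASS graph has to be
a forest in a leaf-peeling order (`K < I → P' K ∉ {P I, P' I}`).  Seat memo CYCLES-CERT.md §1: the comonotone word and the champion rows
depend on the link pattern `σ` only through the set of open classes `σ.image cls`, whose law is the pattern law of the classes with
`Θ_I = 1 − Π_{cls i = I}(1 − θ_i)` (`StarSet.linkSum_pushforward`); so the forest certificate `StarSet.forestCertificate_core` applies at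
class level.

* `StarSet.comonotone_word_nonneg_classForest` — `0 ≤ Σ_σ w(σ)·[μ_w(c ↮_ξ P_σ, |π_ξ(c)| ≤ j) − μ_w(c ↮_ξ P_σ, 1 ≤ |π_ξ(P_σ)| ≤ j)]`
  whenever `c` dominates the designated class ports `P I`.
-/

noncomputable section

namespace Summit.CriticalPhenomena.PercolationContinuityZ3.Theorems

open MeasureTheory Set Literature.Probability.LatticeModels Literature.Probability.Percolation
open scoped Classical BigOperators

variable {n m M : ℕ}

namespace StarSet

/-- Port sets and link sets of a star pattern only see the open CLASSES. [folklore] -/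
theorem portPattern_eq_classPattern (p p' : Fin m → Fin n) (cls : Fin m → Fin M) (P P' : Fin M → Fin n)
    (hP : ∀ i, p i = P (cls i)) (hP' : ∀ i, p' i = P' (cls i)) (σ : Finset (Fin m)) :
    σ.image p ∪ σ.image p' = (σ.image cls).image P ∪ (σ.image cls).image P' := by
  have h1 : p = P ∘ cls := funext hP
  have h2 : p' = P' ∘ cls := funext hP'
  rw [h1, h2, Finset.image_image, Finset.image_image]

/-- Link sets of a star pattern only see the open CLASSES. [folklore] -/
theorem linkPattern_eq_classPattern (p p' : Fin m → Fin n) (cls : Fin m → Fin M) (P P' : Fin M → Fin n)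
    (hP : ∀ i, p i = P (cls i)) (hP' : ∀ i, p' i = P' (cls i)) (σ : Finset (Fin m)) :
    σ.image (fun i => (s(p i, p' i) : Sym2 (Fin n))) = (σ.image cls).image (fun I => (s(P I, P' I) : Sym2 (Fin n))) := by
  have h1 : (fun i => (s(p i, p' i) : Sym2 (Fin n))) = (fun I => (s(P I, P' I) : Sym2 (Fin n))) ∘ cls := by
    funext i
    simp only [Function.comp_apply, hP i, hP' i]
  rw [h1, Finset.image_image]

/-- **The comonotone word is nonnegative for CLASS FORESTS (parallel stars allowed; level `j ≤ 2`).**  As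
`StarSet.comonotone_word_nonneg_forest`, with the stars grouped into parallel classes (`cls`, class ports `P, P'`) and the
leaf-peeling hypothesis imposed on the classes only; `c` must dominate the designated class ports `P I`.
[cite: VandenbergHaggstromKahn2005, Thm. 1.5 (p. 7) — only through the domination hypothesis; the step itself is elementary] -/
theorem comonotone_word_nonneg_classForest (w : Sym2 (Fin n) → unitInterval) (A : Finset (Fin n)) (s p p' : Fin m → Fin n)
    (cls : Fin m → Fin M) (P P' : Fin M → Fin n) (hP : ∀ i, p i = P (cls i)) (hP' : ∀ i, p' i = P' (cls i))
    (c : Fin n) (j : ℕ) (hj : j ≤ 2) (hs : Function.Injective s) (hsA : ∀ i, s i ∉ A)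
    (hPA : ∀ I, P I ∈ A) (hP'A : ∀ I, P' I ∈ A) (hPP' : ∀ I, P I ≠ P' I)
    (hforest : ∀ K I, K < I → P' K ≠ P I ∧ P' K ≠ P' I) (hcA : c ∈ A)
    (hcP : ∀ I, c ≠ P I ∧ c ≠ P' I) (hwjunk : ∀ i u, u ≠ s i → u ≠ p i → u ≠ p' i → w s(s i, u) = 0)
    (hdom : ∀ I, (prodBernoulli w).real {ω : BondConfig (Fin n) | (A.filter fun z => ω ∈ openConn (P I) z).card ≤ j} ≤
      (prodBernoulli w).real {ω : BondConfig (Fin n) | (A.filter fun z => ω ∈ openConn c z).card ≤ j}) :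
    0 ≤ ∑ σ ∈ (Finset.univ : Finset (Fin m)).powerset,
      ((∏ i ∈ σ, ((w s(s i, p i) : ℝ) * w s(s i, p' i))) * ∏ i ∈ Finset.univ \ σ, (1 - (w s(s i, p i) : ℝ) * w s(s i, p' i))) *
        ((prodBernoulli w).real {ω : BondConfig (Fin n) |
            (∀ u ∈ σ.image p ∪ σ.image p', ¬ (openGraph (ω ∩ {e | ∀ v ∈ Finset.univ.image s, v ∉ e})).Reachable c u) ∧
            (A.filter fun z => (openGraph (ω ∩ {e | ∀ v ∈ Finset.univ.image s, v ∉ e})).Reachable c z).card ≤ j} -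
          (prodBernoulli w).real {ω : BondConfig (Fin n) |
            (∀ u ∈ σ.image p ∪ σ.image p', ¬ (openGraph (ω ∩ {e | ∀ v ∈ Finset.univ.image s, v ∉ e})).Reachable c u) ∧
            1 ≤ (A.filter fun z => ∃ u ∈ σ.image p ∪ σ.image p',
              (openGraph (ω ∩ {e | ∀ v ∈ Finset.univ.image s, v ∉ e})).Reachable u z).card ∧
            (A.filter fun z => ∃ u ∈ σ.image p ∪ σ.image p',
              (openGraph (ω ∩ {e | ∀ v ∈ Finset.univ.image s, v ∉ e})).Reachable u z).card ≤ j}) := by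
  -- star-level facts
  have hpA : ∀ i, p i ∈ A := fun i => (hP i) ▸ hPA (cls i)
  have hp'A : ∀ i, p' i ∈ A := fun i => (hP' i) ▸ hP'A (cls i)
  have hpp' : ∀ i, p i ≠ p' i := fun i => by rw [hP i, hP' i]; exact hPP' (cls i)
  have hps : ∀ i k, p i ≠ s k := fun i k h => hsA k (h ▸ hpA i)
  have hp's : ∀ i k, p' i ≠ s k := fun i k h => hsA k (h ▸ hp'A i)
  have hPs : ∀ I k, P I ≠ s k := fun I k h => hsA k (h ▸ hPA I)
  have hP's : ∀ I k, P' I ≠ s k := fun I k h => hsA k (h ▸ hP'A I)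
  have hcs : ∀ i, c ≠ s i := fun i h => hsA i (h ▸ hcA)
  -- star-level and class-level pattern weights
  set θ : Fin m → ℝ := fun i => (w s(s i, p i) : ℝ) * w s(s i, p' i) with hθ
  have hθ0 : ∀ i, 0 ≤ θ i := fun i => mul_nonneg (w _).2.1 (w _).2.1
  have hθ1 : ∀ i, θ i ≤ 1 := fun i => mul_le_one₀ (w _).2.2 (w _).2.1 (w _).2.2
  set uu : Fin M → ℝ := fun I => ∏ i ∈ Finset.univ.filter (fun i => cls i = I), (1 - θ i) with huu
  have huu0 : ∀ I, 0 ≤ uu I := fun I => Finset.prod_nonneg fun i _ => sub_nonneg.2 (hθ1 i)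
  have huu1 : ∀ I, uu I ≤ 1 := fun I => Finset.prod_le_one (fun i _ => sub_nonneg.2 (hθ1 i)) fun i _ => sub_le_self _ (hθ0 i)
  set Θ : Fin M → ℝ := fun I => 1 - uu I with hΘ
  have hΘ0 : ∀ I, 0 ≤ Θ I := fun I => sub_nonneg.2 (huu1 I)
  have hΘ1 : ∀ I, Θ I ≤ 1 := fun I => sub_le_self _ (huu0 I)
  set WΘ : Finset (Fin M) → ℝ := fun S => (∏ I ∈ S, Θ I) * ∏ I ∈ Finset.univ \ S, (1 - Θ I) with hWΘ
  set cf : Fin M → ℝ := fun I => Θ I * ∏ K ∈ Finset.univ.filter (· < I), (1 - Θ K) with hcf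
  have hcf0 : ∀ I, 0 ≤ cf I := fun I => mul_nonneg (hΘ0 I) (Finset.prod_nonneg fun K _ => sub_nonneg.2 (hΘ1 K))
  -- the push-forward, specialised to our weights
  have hpush : ∀ F : Finset (Fin M) → ℝ,
      ∑ σ ∈ (Finset.univ : Finset (Fin m)).powerset, ((∏ i ∈ σ, θ i) * ∏ i ∈ Finset.univ \ σ, (1 - θ i)) * F (σ.image cls) =
        ∑ S ∈ (Finset.univ : Finset (Fin M)).powerset, WΘ S * F S := by
    intro F
    rw [linkSum_pushforward θ cls F]
    refine Finset.sum_congr rfl fun S _ => ?_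
    have hw : WΘ S = (∏ I ∈ S, (1 - ∏ i ∈ Finset.univ.filter (fun i => cls i = I), (1 - θ i))) *
        ∏ I ∈ Finset.univ \ S, ∏ i ∈ Finset.univ.filter (fun i => cls i = I), (1 - θ i) := by
      simp only [hWΘ, hΘ, huu, sub_sub_cancel]
    rw [hw]
  -- class-level events
  set ξ : BondConfig (Fin n) → BondConfig (Fin n) := fun ω => ω ∩ {e | ∀ v ∈ Finset.univ.image s, v ∉ e} with hξ
  set D₁ : Finset (Fin M) → Set (BondConfig (Fin n)) := fun S => {ω |
    (∀ u ∈ S.image P ∪ S.image P', ¬ (openGraph (ξ ω)).Reachable c u) ∧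
      (A.filter fun z => (openGraph (ξ ω)).Reachable c z).card ≤ j} with hD₁
  set D₂ : Finset (Fin M) → Set (BondConfig (Fin n)) := fun S => {ω |
    (∀ u ∈ S.image P ∪ S.image P', ¬ (openGraph (ξ ω)).Reachable c u) ∧
      1 ≤ (A.filter fun z => ∃ u ∈ S.image P ∪ S.image P', (openGraph (ξ ω)).Reachable u z).card ∧
      (A.filter fun z => ∃ u ∈ S.image P ∪ S.image P', (openGraph (ξ ω)).Reachable u z).card ≤ j} with hD₂
  set G : Finset (Fin M) → Set (BondConfig (Fin n)) := fun S => {ω |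
    (A.filter fun z => (openGraph (ξ ω ∪ ↑(S.image fun I => (s(P I, P' I) : Sym2 (Fin n))))).Reachable c z).card ≤ j}
    with hG
  set Sp : Fin M → Finset (Fin M) → Set (BondConfig (Fin n)) := fun I S => {ω |
    (A.filter fun z => (openGraph (ξ ω ∪ ↑(S.image fun I => (s(P I, P' I) : Sym2 (Fin n))))).Reachable (P I) z).card ≤ j}
    with hSp
  -- (0) the star-level word is the class-level word
  have hword : ∑ σ ∈ (Finset.univ : Finset (Fin m)).powerset,
      ((∏ i ∈ σ, ((w s(s i, p i) : ℝ) * w s(s i, p' i))) * ∏ i ∈ Finset.univ \ σ, (1 - (w s(s i, p i) : ℝ) * w s(s i, p' i))) *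
        ((prodBernoulli w).real {ω : BondConfig (Fin n) |
            (∀ u ∈ σ.image p ∪ σ.image p', ¬ (openGraph (ω ∩ {e | ∀ v ∈ Finset.univ.image s, v ∉ e})).Reachable c u) ∧
            (A.filter fun z => (openGraph (ω ∩ {e | ∀ v ∈ Finset.univ.image s, v ∉ e})).Reachable c z).card ≤ j} -
          (prodBernoulli w).real {ω : BondConfig (Fin n) |
            (∀ u ∈ σ.image p ∪ σ.image p', ¬ (openGraph (ω ∩ {e | ∀ v ∈ Finset.univ.image s, v ∉ e})).Reachable c u) ∧
            1 ≤ (A.filter fun z => ∃ u ∈ σ.image p ∪ σ.image p',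
              (openGraph (ω ∩ {e | ∀ v ∈ Finset.univ.image s, v ∉ e})).Reachable u z).card ∧
            (A.filter fun z => ∃ u ∈ σ.image p ∪ σ.image p',
              (openGraph (ω ∩ {e | ∀ v ∈ Finset.univ.image s, v ∉ e})).Reachable u z).card ≤ j}) =
      ∑ S ∈ (Finset.univ : Finset (Fin M)).powerset, WΘ S * ((prodBernoulli w).real (D₁ S) - (prodBernoulli w).real (D₂ S)) := by
    rw [← hpush (fun S => (prodBernoulli w).real (D₁ S) - (prodBernoulli w).real (D₂ S))]
    refine Finset.sum_congr rfl fun σ _ => ?_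
    simp only [hD₁, hD₂, hξ, portPattern_eq_classPattern p p' cls P P' hP hP' σ]
    rfl
  rw [hword]
  -- (1) pointwise certificate at class level
  have hpt : ∀ ω : BondConfig (Fin n),
      ∑ I, cf I * ∑ S ∈ (Finset.univ : Finset (Fin M)).powerset, WΘ S * (DecisionTree.ind (G S) ω - DecisionTree.ind (Sp I S) ω) ≤
        ∑ S ∈ (Finset.univ : Finset (Fin M)).powerset, WΘ S * (DecisionTree.ind (D₁ S) ω - DecisionTree.ind (D₂ S) ω) := by
    intro ω
    have hi : ∀ S, DecisionTree.ind (D₁ S) ω = DecisionTree.ind (G S) ω := by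
      intro S
      have hΛ : ∀ l ∈ S.image (fun I => (s(P I, P' I) : Sym2 (Fin n))),
          ∃ q q', l = s(q, q') ∧ q ≠ q' ∧ q ∈ A ∧ q' ∈ A ∧ q ≠ c ∧ q' ≠ c := by
        intro l hl
        obtain ⟨I, -, rfl⟩ := Finset.mem_image.1 hl
        exact ⟨P I, P' I, rfl, hPP' I, hPA I, hP'A I, (hcP I).1.symm, (hcP I).2.symm⟩
      have key := sepSmall_links_iff (ξ ω) (S.image fun I => (s(P I, P' I) : Sym2 (Fin n))) A ∅ c j hj hcA hΛ
      have hiff : ω ∈ D₁ S ↔ ω ∈ G S := by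
        simp only [hD₁, hG, mem_setOf_eq]
        constructor
        · rintro ⟨hsep, hsmall⟩
          have h3 := key.1 ⟨fun y hy => absurd hy (Finset.notMem_empty y),
            fun l hl v hv => hsep v ((mem_portPattern_iff P P' S v).2 ⟨l, hl, hv⟩), by convert hsmall using 4⟩
          convert h3.2 using 4
        · intro hsmall
          have h3 := key.2 ⟨fun y hy => absurd hy (Finset.notMem_empty y), by convert hsmall using 4⟩
          refine ⟨fun u hu => ?_, by convert h3.2.2 using 4⟩
          obtain ⟨l, hl, hul⟩ := (mem_portPattern_iff P P' S u).1 hu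
          exact h3.2.1 l hl u hul
      by_cases hω : ω ∈ D₁ S
      · rw [DecisionTree.ind_of_mem hω, DecisionTree.ind_of_mem (hiff.1 hω)]
      · rw [DecisionTree.ind_of_not_mem hω, DecisionTree.ind_of_not_mem (fun h => hω (hiff.2 h))]
    have hrhs : ∑ S ∈ (Finset.univ : Finset (Fin M)).powerset, WΘ S * (DecisionTree.ind (D₁ S) ω - DecisionTree.ind (D₂ S) ω) =
        ∑ S ∈ (Finset.univ : Finset (Fin M)).powerset, WΘ S * (DecisionTree.ind (G S) ω - DecisionTree.ind (D₂ S) ω) := by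
      refine Finset.sum_congr rfl fun S _ => ?_
      rw [hi S]
    rw [hrhs]
    -- no two classes have the same pair of ports (leaf peeling)
    have hnopar : ∀ I K : Fin M, I ≠ K → ¬ ((P K = P I ∨ P K = P' I) ∧ (P' K = P I ∨ P' K = P' I)) := by
      intro I K hIK hpar
      rcases lt_or_gt_of_ne hIK with h | h
      · have hf := hforest I K h
        obtain ⟨h1, h2⟩ := hpar
        rcases h1 with h1 | h1 <;> rcases h2 with h2 | h2
        · exact hPP' K (h1.trans h2.symm)
        · exact hf.2 h2.symm
        · exact hf.1 h1.symm
        · exact hPP' K (h1.trans h2.symm)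
      · exact (hforest K I h).elim (fun h1 h2 => hpar.2.elim h1 h2)
    have hlonelyOf : ∀ I, DecisionTree.ind (D₂ {I}) ω ≠ 0 →
        (A.filter fun z => ∃ u ∈ ({I} : Finset (Fin M)).image P ∪ ({I} : Finset (Fin M)).image P',
          (openGraph (ξ ω)).Reachable u z).card ≤ j := by
      intro I hne
      by_cases hω : ω ∈ D₂ {I}
      · simp only [hD₂, mem_setOf_eq] at hω
        exact hω.2.2
      · exact absurd (DecisionTree.ind_of_not_mem hω) hne
    refine forestCertificate_core Θ hΘ0 hΘ1 P P' hforest (fun S => DecisionTree.ind (G S) ω) (fun S => DecisionTree.ind (D₂ S) ω)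
      (fun v S => DecisionTree.ind {ω' : BondConfig (Fin n) |
        (A.filter fun z => (openGraph (ξ ω' ∪ ↑(S.image fun I => (s(P I, P' I) : Sym2 (Fin n))))).Reachable v z).card ≤ j} ω)
      (fun I => DecisionTree.ind (D₂ {I}) ω ≠ 0 ∧ ¬ (openGraph (ξ ω)).Reachable (P I) (P' I))
      (fun I => DecisionTree.ind (D₂ {I}) ω ≠ 0 ∧ (openGraph (ξ ω)).Reachable (P I) (P' I))
      (fun S => DecisionTree.ind_nonneg _ _) ?_ (fun I => BHK2006.ind_le_one _ _) (fun v S => DecisionTree.ind_nonneg _ _)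
      ?_ ?_ ?_ ?_ ?_
    · -- only singletons are lonely
      intro S hS
      refine DecisionTree.ind_of_not_mem fun hω => ?_
      simp only [hD₂, mem_setOf_eq] at hω
      obtain ⟨I, rfl⟩ := portPattern_lonely_singleton' (ξ ω) A P P' S j hj hPA hP'A hPP'
        (fun I _ K _ hIK => hnopar I K hIK) (hω.2.1.trans_eq (card_filter_congr fun _ _ => Iff.rfl))
        ((card_filter_congr fun _ _ => Iff.rfl).trans_le hω.2.2)
      exact hS I rfl
    · -- lonely classes are of type A or B
      intro I hne
      by_cases h : (openGraph (ξ ω)).Reachable (P I) (P' I)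
      · exact Or.inr ⟨hne, h⟩
      · exact Or.inl ⟨hne, h⟩
    · -- type A: budget events Z and E
      rintro I ⟨hne, hA⟩
      have hl := hlonelyOf I hne
      constructor
      · intro S hS
        refine DecisionTree.ind_of_mem ?_
        simp only [mem_setOf_eq]
        exact (card_filter_congr fun _ _ => Iff.rfl).trans_le
          (lonely_port_light_closed (ξ ω) A P P' I S j hj hPA hP'A hPP' ((card_filter_congr fun _ _ => Iff.rfl).trans_le hl) hA
            (fun K hK => ⟨fun h => hS K (Or.inl h) hK, fun h => hS K (Or.inr h) hK⟩))
      · intro S _ hS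
        have h2 := lonely_ports_light_adj (ξ ω) A P P' I S j hj hPA hP'A hPP' ((card_filter_congr fun _ _ => Iff.rfl).trans_le hl)
          (fun K hK hKI hadj => hS K hKI hadj hK)
        exact ⟨DecisionTree.ind_of_mem (by
            simp only [mem_setOf_eq]; exact (card_filter_congr fun _ _ => Iff.rfl).trans_le h2.1),
          DecisionTree.ind_of_mem (by
            simp only [mem_setOf_eq]; exact (card_filter_congr fun _ _ => Iff.rfl).trans_le h2.2)⟩
    · -- type B: budget event F
      rintro I ⟨hne, -⟩ S hS
      have h2 := lonely_ports_light_adj (ξ ω) A P P' I S j hj hPA hP'A hPP' ((card_filter_congr fun _ _ => Iff.rfl).trans_le (hlonelyOf I hne))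
        (fun K hK hKI hadj => hS K hKI hadj hK)
      exact ⟨DecisionTree.ind_of_mem (by
          simp only [mem_setOf_eq]; exact (card_filter_congr fun _ _ => Iff.rfl).trans_le h2.1),
        DecisionTree.ind_of_mem (by
          simp only [mem_setOf_eq]; exact (card_filter_congr fun _ _ => Iff.rfl).trans_le h2.2)⟩
    · -- types A and B never adjacent
      rintro K I ⟨hneK, hAK⟩ ⟨hneI, hBI⟩ hadj
      exact lonely_types_exclusive (ξ ω) A P P' K I j hj hPA hP'A hPP' ((card_filter_congr fun _ _ => Iff.rfl).trans_le (hlonelyOf K hneK)) hAK hBI hadj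
    · -- two type-B lonely classes never adjacent
      rintro I I' hII' ⟨hneI, hBI⟩ ⟨hneI', hBI'⟩ hadj
      have h1 := lonely_typeB_ports_subset (ξ ω) A P P' I I' j hj hPA hP'A hPP' ((card_filter_congr fun _ _ => Iff.rfl).trans_le (hlonelyOf I' hneI')) hBI hadj
      rcases lt_or_gt_of_ne hII' with h | h
      · exact (hforest I I' h).elim (fun ha hb => h1.2.elim ha hb)
      · have hadj' : P I' = P I ∨ P I' = P' I ∨ P' I' = P I ∨ P' I' = P' I := by
          rcases hadj with h' | h' | h' | h'
          · exact Or.inl h'.symm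
          · exact Or.inr (Or.inr (Or.inl h'.symm))
          · exact Or.inr (Or.inl h'.symm)
          · exact Or.inr (Or.inr (Or.inr h'.symm))
        have h2 := lonely_typeB_ports_subset (ξ ω) A P P' I' I j hj hPA hP'A hPP' ((card_filter_congr fun _ _ => Iff.rfl).trans_le (hlonelyOf I hneI)) hBI' hadj'
        exact (hforest I' I h).elim (fun ha hb => h2.2.elim ha hb)
  -- (2) integrate
  have hwt0 : ∀ e : Sym2 (Fin n), 0 ≤ ((w e : unitInterval) : ℝ) := fun e => (w e).2.1
  have hwt1 : ∀ e : Sym2 (Fin n), ((w e : unitInterval) : ℝ) ≤ 1 := fun e => (w e).2.2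
  have hlower : ∑ I, cf I * ∑ S ∈ (Finset.univ : Finset (Fin M)).powerset,
        WΘ S * ((prodBernoulli w).real (G S) - (prodBernoulli w).real (Sp I S)) ≤
      ∑ S ∈ (Finset.univ : Finset (Fin M)).powerset, WΘ S * ((prodBernoulli w).real (D₁ S) - (prodBernoulli w).real (D₂ S)) := by
    rw [linkSum_real_sub_eq_sum w WΘ D₁ D₂]
    have hl : ∑ I, cf I * ∑ S ∈ (Finset.univ : Finset (Fin M)).powerset,
          WΘ S * ((prodBernoulli w).real (G S) - (prodBernoulli w).real (Sp I S)) =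
        ∑ ω : BondConfig (Fin n), BHK2006.weight (fun e => (w e : ℝ)) ω *
          ∑ I, cf I * ∑ S ∈ (Finset.univ : Finset (Fin M)).powerset, WΘ S * (DecisionTree.ind (G S) ω - DecisionTree.ind (Sp I S) ω) := by
      calc ∑ I, cf I * ∑ S ∈ (Finset.univ : Finset (Fin M)).powerset,
            WΘ S * ((prodBernoulli w).real (G S) - (prodBernoulli w).real (Sp I S))
          = ∑ I, ∑ ω : BondConfig (Fin n), cf I * (BHK2006.weight (fun e => (w e : ℝ)) ω *
              ∑ S ∈ (Finset.univ : Finset (Fin M)).powerset, WΘ S * (DecisionTree.ind (G S) ω - DecisionTree.ind (Sp I S) ω)) := by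
            refine Finset.sum_congr rfl fun I _ => ?_
            rw [linkSum_real_sub_eq_sum w WΘ G (Sp I), Finset.mul_sum]
        _ = ∑ ω : BondConfig (Fin n), ∑ I, cf I * (BHK2006.weight (fun e => (w e : ℝ)) ω *
              ∑ S ∈ (Finset.univ : Finset (Fin M)).powerset, WΘ S * (DecisionTree.ind (G S) ω - DecisionTree.ind (Sp I S) ω)) :=
            Finset.sum_comm
        _ = _ := by
            refine Finset.sum_congr rfl fun ω _ => ?_
            rw [Finset.mul_sum]
            refine Finset.sum_congr rfl fun I _ => ?_
            ring
    rw [hl]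
    exact Finset.sum_le_sum fun ω _ => mul_le_mul_of_nonneg_left (hpt ω) (BHK2006.weight_nonneg hwt0 hwt1 ω)
  -- (3) the lower bound is `Σ_I c_I (I_w(c) − I_w(P I)) ≥ 0`
  have hGσ : ∀ σ : Finset (Fin m), (prodBernoulli w).real (G (σ.image cls)) =
      (prodBernoulli w).real {ω : BondConfig (Fin n) |
        (A.filter fun z => (openGraph ((ω ∩ {e | ∀ v ∈ Finset.univ.image s, v ∉ e}) ∪
          ↑(σ.image fun i => (s(p i, p' i) : Sym2 (Fin n))))).Reachable c z).card ≤ j} := by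
    intro σ
    simp only [hG, hξ, linkPattern_eq_classPattern p p' cls P P' hP hP' σ]
  have hSpσ : ∀ (I : Fin M) (σ : Finset (Fin m)), (prodBernoulli w).real (Sp I (σ.image cls)) =
      (prodBernoulli w).real {ω : BondConfig (Fin n) |
        (A.filter fun z => (openGraph ((ω ∩ {e | ∀ v ∈ Finset.univ.image s, v ∉ e}) ∪
          ↑(σ.image fun i => (s(p i, p' i) : Sym2 (Fin n))))).Reachable (P I) z).card ≤ j} := by
    intro I σ
    simp only [hSp, hξ, linkPattern_eq_classPattern p p' cls P P' hP hP' σ]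
  have hIc : (prodBernoulli w).real {ω : BondConfig (Fin n) | (A.filter fun z => ω ∈ openConn c z).card ≤ j} =
      ∑ S ∈ (Finset.univ : Finset (Fin M)).powerset, WΘ S * (prodBernoulli w).real (G S) := by
    have h := lightness_eq_linkSum w A s p p' c j hs hps hp's hpp' hwjunk hsA hcs
    rw [← hpush (fun S => (prodBernoulli w).real (G S))]
    have h2 : ∑ σ ∈ (Finset.univ : Finset (Fin m)).powerset, ((∏ i ∈ σ, θ i) * ∏ i ∈ Finset.univ \ σ, (1 - θ i)) *
        (fun S => (prodBernoulli w).real (G S)) (σ.image cls) =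
      ∑ σ ∈ (Finset.univ : Finset (Fin m)).powerset, ((∏ i ∈ σ, θ i) * ∏ i ∈ Finset.univ \ σ, (1 - θ i)) *
        (prodBernoulli w).real {ω : BondConfig (Fin n) |
          (A.filter fun z => (openGraph ((ω ∩ {e | ∀ v ∈ Finset.univ.image s, v ∉ e}) ∪
            ↑(σ.image fun i => (s(p i, p' i) : Sym2 (Fin n))))).Reachable c z).card ≤ j} := by
      refine Finset.sum_congr rfl fun σ _ => ?_
      simp only [hGσ σ]
    rw [h2]
    convert h using 12
    exact Iff.rfl
  have hIp : ∀ I, (prodBernoulli w).real {ω : BondConfig (Fin n) | (A.filter fun z => ω ∈ openConn (P I) z).card ≤ j} =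
      ∑ S ∈ (Finset.univ : Finset (Fin M)).powerset, WΘ S * (prodBernoulli w).real (Sp I S) := by
    intro I
    have h := lightness_eq_linkSum w A s p p' (P I) j hs hps hp's hpp' hwjunk hsA (fun k => hPs I k)
    rw [← hpush (fun S => (prodBernoulli w).real (Sp I S))]
    have h2 : ∑ σ ∈ (Finset.univ : Finset (Fin m)).powerset, ((∏ i ∈ σ, θ i) * ∏ i ∈ Finset.univ \ σ, (1 - θ i)) *
        (fun S => (prodBernoulli w).real (Sp I S)) (σ.image cls) =
      ∑ σ ∈ (Finset.univ : Finset (Fin m)).powerset, ((∏ i ∈ σ, θ i) * ∏ i ∈ Finset.univ \ σ, (1 - θ i)) *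
        (prodBernoulli w).real {ω : BondConfig (Fin n) |
          (A.filter fun z => (openGraph ((ω ∩ {e | ∀ v ∈ Finset.univ.image s, v ∉ e}) ∪
            ↑(σ.image fun i => (s(p i, p' i) : Sym2 (Fin n))))).Reachable (P I) z).card ≤ j} := by
      refine Finset.sum_congr rfl fun σ _ => ?_
      simp only [hSpσ I σ]
    rw [h2]
    convert h using 12
    exact Iff.rfl
  have hlb : 0 ≤ ∑ I, cf I * ∑ S ∈ (Finset.univ : Finset (Fin M)).powerset,
      WΘ S * ((prodBernoulli w).real (G S) - (prodBernoulli w).real (Sp I S)) := by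
    refine Finset.sum_nonneg fun I _ => mul_nonneg (hcf0 I) ?_
    have heq : ∑ S ∈ (Finset.univ : Finset (Fin M)).powerset, WΘ S * ((prodBernoulli w).real (G S) - (prodBernoulli w).real (Sp I S)) =
        (prodBernoulli w).real {ω : BondConfig (Fin n) | (A.filter fun z => ω ∈ openConn c z).card ≤ j} -
          (prodBernoulli w).real {ω : BondConfig (Fin n) | (A.filter fun z => ω ∈ openConn (P I) z).card ≤ j} := by
      rw [hIc, hIp I, ← Finset.sum_sub_distrib]
      refine Finset.sum_congr rfl fun S _ => ?_
      ring
    rw [heq]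
    exact sub_nonneg.2 (hdom I)
  exact le_trans hlb hlower

end StarSet

end Summit.CriticalPhenomena.PercolationContinuityZ3.Theorems

end
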